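import Mathlib
import HarnessLib

/-!
# Route LiouvilleSarnak — support `AlignedTypeI` (stmt-ValiantsHypothesis-21040), line `characters_mod_2n`:
# the first range of Banks–Shparlinski's saving `E₂` is eventually small in the leaf's regime `log x ≥ θ log q`

Brick for the last lemma of the chain (with `…BilinearSieveRanges.lean`).  With `u = log x`, `L = log q`: in the first range
`u ≤ L^{7/3} (log L)^{5/3}` and in the leaf's regime `u ≥ θ L`,
`(log x)² exp(−c u L^{−2/3} (log L)^{−4/3}) ≤ 1024 L^{61/12} exp(−(cθ/16) L^{1/6}) → 0`, hence `≤ ε` for `L ≥ L₁(c, θ, ε)`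
(`bs_range1_small`).  Ingredients: `log L ≤ 8 L^{1/8}` and Mathlib's `tendsto_rpow_mul_exp_neg_mul_atTop_nhds_zero`.

HONEST FRAMING. Pure real analysis; `AlignedTypeI` is NOT closed here; nothing bears on `VP ≠ VNP` (NOT proved).
-/

set_option linter.dupNamespace false

noncomputable section

namespace Summit.ValiantsHypothesis.ValiantsHypothesis.Theorems.LiouvilleSarnak.AlignedTypeI.CharactersModTwoN

open Filter Topology

/-- `log L ≤ 8 L^{1/8}` for `L > 0`. [folklore] -/
theorem log_le_eight_mul_rpow_eighth {L : ℝ} (hL : 0 < L) : Real.log L ≤ 8 * L ^ (1 / 8 : ℝ) := by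
  have h1 : Real.log (L ^ (1 / 8 : ℝ)) = (1 / 8 : ℝ) * Real.log L := Real.log_rpow hL _
  have h2 : Real.log (L ^ (1 / 8 : ℝ)) ≤ L ^ (1 / 8 : ℝ) - 1 := Real.log_le_sub_one_of_pos (Real.rpow_pos_of_pos hL _)
  rw [h1] at h2
  linarith

/-- **First range.**  For `c, θ, ε > 0` there is `L₁` such that for all `L ≥ L₁` and all `u` with `θ L ≤ u ≤ L^{7/3} (log L)^{5/3}`:
`exp(−(c · u · L^{−2/3} · (log L)^{−4/3})) · u² ≤ ε` (`u = log x`, `L = log q` in Banks–Shparlinski 2019 Thm 2.2). [folklore] -/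
theorem bs_range1_small {c θ ε : ℝ} (hc : 0 < c) (hθ : 0 < θ) (hε : 0 < ε) :
    ∃ L₁ : ℝ, ∀ L : ℝ, L₁ ≤ L → ∀ u : ℝ, θ * L ≤ u → u ≤ L ^ (7 / 3 : ℝ) * Real.log L ^ (5 / 3 : ℝ) →
      Real.exp (-(c * u * L ^ (-(2 / 3 : ℝ)) * Real.log L ^ (-(4 / 3 : ℝ)))) * u ^ 2 ≤ ε := by
  -- the comparison function `g(y) = 1024 y^{61/2} exp(−(cθ/16) y)` at `y = L^{1/6}` tends to `0`
  have hb : 0 < c * θ / 16 := by positivity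
  have hg : Tendsto (fun y : ℝ => (1024 : ℝ) * (y ^ (61 / 2 : ℝ) * Real.exp (-(c * θ / 16) * y))) atTop (𝓝 0) := by
    have := (tendsto_rpow_mul_exp_neg_mul_atTop_nhds_zero (61 / 2 : ℝ) (c * θ / 16) hb).const_mul (1024 : ℝ)
    simpa using this
  have hcomp := hg.comp (tendsto_rpow_atTop (show (0 : ℝ) < 1 / 6 by norm_num))
  have hev : ∀ᶠ L : ℝ in atTop,
      (1024 : ℝ) * ((L ^ (1 / 6 : ℝ)) ^ (61 / 2 : ℝ) * Real.exp (-(c * θ / 16) * L ^ (1 / 6 : ℝ))) < ε :=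
    hcomp.eventually (Iio_mem_nhds hε)
  obtain ⟨L₀, hL₀⟩ := Filter.eventually_atTop.mp hev
  refine ⟨max L₀ 3, fun L hL u hul huu => ?_⟩
  have hL3 : 3 ≤ L := le_trans (le_max_right _ _) hL
  have hL0 : 0 < L := by linarith
  have hL1 : 1 ≤ L := by linarith
  have hsmall := hL₀ L (le_trans (le_max_left _ _) hL)
  have hu0 : 0 < u := lt_of_lt_of_le (by positivity) hul
  -- `m = log L`: `1 ≤ m ≤ 8 L^{1/8}`
  have hm1 : 1 ≤ Real.log L := by
    rw [← Real.log_exp 1]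
    refine Real.log_le_log (Real.exp_pos 1) (le_trans ?_ hL3)
    have := Real.exp_one_lt_d9
    linarith
  have hm0 : 0 < Real.log L := by linarith
  have hm8 : Real.log L ≤ 8 * L ^ (1 / 8 : ℝ) := log_le_eight_mul_rpow_eighth hL0
  have hL8 : 0 < L ^ (1 / 8 : ℝ) := Real.rpow_pos_of_pos hL0 _
  -- (a) the exponent: `c u L^{-2/3} m^{-4/3} ≥ (cθ/16) L^{1/6}`
  have ha1 : (8 * L ^ (1 / 8 : ℝ)) ^ (-(4 / 3 : ℝ)) ≤ Real.log L ^ (-(4 / 3 : ℝ)) :=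
    (Real.rpow_le_rpow_iff_of_neg (by positivity) hm0 (by norm_num)).mpr hm8
  have ha2 : (8 * L ^ (1 / 8 : ℝ)) ^ (-(4 / 3 : ℝ)) = (1 / 16) * L ^ (-(1 / 6 : ℝ)) := by
    rw [Real.mul_rpow (by norm_num) hL8.le, ← Real.rpow_mul hL0.le]
    have h8 : (8 : ℝ) ^ (-(4 / 3 : ℝ)) = 1 / 16 := by
      rw [show (8 : ℝ) = 2 ^ (3 : ℝ) by norm_num, ← Real.rpow_mul (by norm_num)]
      rw [show (3 : ℝ) * -(4 / 3 : ℝ) = -(4 : ℝ) by norm_num, Real.rpow_neg (by norm_num)]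
      norm_num
    rw [h8]
    norm_num
  have ha3 : L * L ^ (-(2 / 3 : ℝ)) * L ^ (-(1 / 6 : ℝ)) = L ^ (1 / 6 : ℝ) := by
    rw [show L * L ^ (-(2 / 3 : ℝ)) = L ^ (1 : ℝ) * L ^ (-(2 / 3 : ℝ)) by rw [Real.rpow_one],
      ← Real.rpow_add hL0, ← Real.rpow_add hL0]
    norm_num
  have hexp : c * θ / 16 * L ^ (1 / 6 : ℝ) ≤ c * u * L ^ (-(2 / 3 : ℝ)) * Real.log L ^ (-(4 / 3 : ℝ)) := by
    have hL23 : 0 ≤ L ^ (-(2 / 3 : ℝ)) := Real.rpow_nonneg hL0.le _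
    have hL16 : 0 ≤ L ^ (-(1 / 6 : ℝ)) := Real.rpow_nonneg hL0.le _
    calc c * θ / 16 * L ^ (1 / 6 : ℝ) = c * (θ * L) * L ^ (-(2 / 3 : ℝ)) * ((1 / 16) * L ^ (-(1 / 6 : ℝ))) := by
          rw [← ha3]; ring
      _ ≤ c * u * L ^ (-(2 / 3 : ℝ)) * ((1 / 16) * L ^ (-(1 / 6 : ℝ))) := by gcongr
      _ ≤ c * u * L ^ (-(2 / 3 : ℝ)) * Real.log L ^ (-(4 / 3 : ℝ)) := by
          rw [← ha2]
          exact mul_le_mul_of_nonneg_left ha1 (by positivity)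
  -- (b) the polynomial factor: `u² ≤ 1024 L^{61/12} = 1024 (L^{1/6})^{61/2}`
  have hb1 : Real.log L ^ (5 / 3 : ℝ) ≤ (8 * L ^ (1 / 8 : ℝ)) ^ (5 / 3 : ℝ) :=
    Real.rpow_le_rpow hm0.le hm8 (by norm_num)
  have hb2 : (8 * L ^ (1 / 8 : ℝ)) ^ (5 / 3 : ℝ) = 32 * L ^ (5 / 24 : ℝ) := by
    rw [Real.mul_rpow (by norm_num) hL8.le, ← Real.rpow_mul hL0.le]
    have h8 : (8 : ℝ) ^ (5 / 3 : ℝ) = 32 := by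
      rw [show (8 : ℝ) = 2 ^ (3 : ℝ) by norm_num, ← Real.rpow_mul (by norm_num)]
      norm_num
    rw [h8]
    norm_num
  have hb3 : u ≤ 32 * L ^ (61 / 24 : ℝ) := by
    calc u ≤ L ^ (7 / 3 : ℝ) * Real.log L ^ (5 / 3 : ℝ) := huu
      _ ≤ L ^ (7 / 3 : ℝ) * (32 * L ^ (5 / 24 : ℝ)) := by
          rw [← hb2]; exact mul_le_mul_of_nonneg_left hb1 (Real.rpow_nonneg hL0.le _)
      _ = 32 * (L ^ (7 / 3 : ℝ) * L ^ (5 / 24 : ℝ)) := by ring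
      _ = 32 * L ^ (61 / 24 : ℝ) := by rw [← Real.rpow_add hL0]; norm_num
  have hb4 : u ^ 2 ≤ 1024 * (L ^ (1 / 6 : ℝ)) ^ (61 / 2 : ℝ) := by
    have h1 : u ^ 2 ≤ (32 * L ^ (61 / 24 : ℝ)) ^ 2 := pow_le_pow_left₀ hu0.le hb3 2
    have h2 : (32 * L ^ (61 / 24 : ℝ)) ^ 2 = 1024 * (L ^ (1 / 6 : ℝ)) ^ (61 / 2 : ℝ) := by
      rw [mul_pow, ← Real.rpow_mul hL0.le, ← Real.rpow_natCast (L ^ (61 / 24 : ℝ)) 2, ← Real.rpow_mul hL0.le]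
      norm_num
    rw [← h2]; exact h1
  -- combine
  have hE : Real.exp (-(c * u * L ^ (-(2 / 3 : ℝ)) * Real.log L ^ (-(4 / 3 : ℝ)))) ≤
      Real.exp (-(c * θ / 16) * L ^ (1 / 6 : ℝ)) := Real.exp_le_exp.mpr (by linarith)
  calc Real.exp (-(c * u * L ^ (-(2 / 3 : ℝ)) * Real.log L ^ (-(4 / 3 : ℝ)))) * u ^ 2
      ≤ Real.exp (-(c * θ / 16) * L ^ (1 / 6 : ℝ)) * (1024 * (L ^ (1 / 6 : ℝ)) ^ (61 / 2 : ℝ)) :=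
        mul_le_mul hE hb4 (sq_nonneg _) (Real.exp_pos _).le
    _ = (1024 : ℝ) * ((L ^ (1 / 6 : ℝ)) ^ (61 / 2 : ℝ) * Real.exp (-(c * θ / 16) * L ^ (1 / 6 : ℝ))) := by ring
    _ ≤ ε := hsmall.le

end Summit.ValiantsHypothesis.ValiantsHypothesis.Theorems.LiouvilleSarnak.AlignedTypeI.CharactersModTwoN
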